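import Summits.ResolutionOfSingularities.ResolutionOfSingularities.Theorems.FrobeniusLadderFInjectiveMacaulayficationDimSliceCM
import Summits.ResolutionOfSingularities.ResolutionOfSingularities.Theorems.FrobeniusLadderFInjectiveMacaulayficationOfCesnaviciusFact
import HarnessLib

/-!
# THE DIM-`d` SLICES BY NAME: on schemes of dimension `≤ d`, `FInjectiveMacaulayfication` ⟸ FOUR PUBLISHED THEOREMS {CP 2019 Thm 1.1, R–G 081R,
# CP 2019 Prop 4.4, Česnavičius 2021 Thm 5.3 (Literature named fact, p602953)} ∧ closed-point admissible local resolution at levels `4 … d − 1`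
# over `k(X₁,…,X_r)` ∧ the F-half at levels `4 … d` (crux `FInjectiveMacaulayfication` stmt-ResolutionOfSingularities-15315, chain w45a; res-L1-w45a-plan-1
# SEAT TABLE v31.2 03:50:22Z «the BY-NAME per-dimension corollaries in one small file … settle authorship with stub-3» — res-L1-w45a-stub-2 g6 closed,
# this seat files; seat res-L1-w45a-stub-3 g8)

[OURS · L1 W4.5a] Support file (`--supports stmt-ResolutionOfSingularities-15315 --as helper`); replaces the role of NO printed item; NOT a statement of any
manuscript; def-free. CONDITIONAL on FOUR printed theorems BY NAME — `CossartPiltant2019General`, `Stacks081R`, `CossartPiltant2019Principalization`, and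
`Literature.AlgebraicGeometry.Resolution.CesnaviciusBlowupMacaulayficationOffClosed` (door v37's reading (B); the (A) name `CesnaviciusBlowupMacaulayfication`
through `OfCesnaviciusFact.cesnaviciusOffClosed_of_cesnavicius`) — and on the chain's CANDIDATE rungs (`ClosedPointLocalResolutionAdmTr p e r`, p602502) and
CANDIDATE F-half (`LocalFullificationFibreAdmGe4Split.LocalFInjectivizationFibreAdmGe4`'s body per level). AI-written (AI review is weaker than expert review).
Upward wording (DR-CZ3 (iv)): «conditional on four published theorems + the rungs + the F-half», never «proved».

* (companion `DimSliceCM`: the slice over an ABSTRACT CM-centre supplier `hCM`, proofs of `DimSlice` §2–§3 verbatim with `hM` ↦ `hCM`.)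
* §1 the suppliers from the Literature names: `cmSupplier_of_cesnaviciusOffClosed`, `cmSupplier_of_cesnavicius`.
* §2 ★ BY NAME: `fInjectiveMacaulayfication_dimLe_of_cesnaviciusOffClosed_of_rungs_of_F (d) (hG h081R hP) (hM : …OffClosed) (hR) (hF)` (+ `_of_LFadmF`,
  + the (A)-name twin); ★★ **`fInjectiveMacaulayfication_dimLe4_of_cesnaviciusOffClosed_of_F4 (hG h081R hP) (hM) (hF4) : «crux ∀-text + dim X ≤ 4»`** —
  FOUR PUBLISHED THEOREMS ∧ F-half(4), NO resolution residue; ★ **`fInjectiveMacaulayfication_dimLe5_of_cesnaviciusOffClosed_of_tr4_of_F45 (hG h081R hP) (hM)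
  (hR4 : ∀ p r, p.Prime → 1 ≤ r → ClosedPointLocalResolutionAdmTr p 4 r) (hF4) (hF5) : «crux ∀-text + dim X ≤ 5»`** — four published theorems ∧
  closed-point admissible local resolution of 4-folds over `k(X₁,…,X_r)`, `r ≥ 1` ∧ F-half(4), F-half(5).

[folklore assembly; cite: Temkin2008, Prop. 2.3.4; CossartPiltant2019, Thm. 1.1 (i)(ii) and Prop. 4.4; Cesnavicius2021, Thm. 5.3; RaynaudGruson1971, Thm. 5.2.2]
-/

-- single-problem summit: the doubled namespace component is forced
set_option linter.dupNamespace false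

noncomputable section

namespace Summit.ResolutionOfSingularities.ResolutionOfSingularities.Theorems.FInjectiveMacaulayfication.DimSliceOfCesnavicius

open CategoryTheory CategoryTheory.Limits AlgebraicGeometry TopologicalSpace IsLocalRing
open Literature.AlgebraicGeometry.Resolution
open Summit.ResolutionOfSingularities.ResolutionOfSingularities.Theorems.FInjectiveMacaulayfication
open SliceableCentre ClosedPointLocalResolutionAdm ClosedPointLocalResolutionAdmTr DimSlice DimSliceCM

/-! ## §1 The CM-centre suppliers from the Literature names -/

/-- **Reading (B) (`CesnaviciusBlowupMacaulayficationOffClosed`, door v37's named fact) supplies CM-centres** at every point of positive local dimension.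
[OURS · conditional-result] [cite: Cesnavicius2021, Thm. 5.3] -/
theorem cmSupplier_of_cesnaviciusOffClosed (hM : CesnaviciusBlowupMacaulayficationOffClosed.{0}) :
    ∀ (p : ℕ), p.Prime → ∀ {k : Type} [Field k] [CharP k p] {X : Scheme.{0}} (f : X ⟶ Spec (.of k))
      [LocallyOfFiniteType f] [IsIntegral X] (x : X), ringKrullDim (X.presheaf.stalk x) ≠ 0 →
      ∀ (S' : Scheme.{0}) (g : S' ⟶ Spec (X.presheaf.stalk x)) (I : (Spec (X.presheaf.stalk x)).IdealSheafData),
        I ≠ ⊥ → IsBlowup g I → (∀ s : S', g.base s ≠ closedPoint (X.presheaf.stalk x) → s ∈ Scheme.regularLocus S') →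
        ∃ 𝓚 : S'.IdealSheafData, 𝓚 ≠ ⊥ ∧ (∀ s ∈ (𝓚.support : Set S'), g.base s = closedPoint (X.presheaf.stalk x)) ∧
          ∀ (S'' : Scheme.{0}) (π : S'' ⟶ S'), IsBlowup π 𝓚 → ∀ s : S'', IsDomain (S''.presheaf.stalk s) ∧ CMCl (S''.presheaf.stalk s) :=
  fun p hp _ _ _ _ f _ _ x hx S' g I hI hg hreg =>
    LocalMacaulayficationOfFactOffClosed.exists_cmCentre_of_factOffClosed hM p hp f x hx S' g I hI hg hreg

/-- **Reading (A) (`CesnaviciusBlowupMacaulayfication`) supplies CM-centres** (through (A) ⇒ (B), `OfCesnaviciusFact.cesnaviciusOffClosed_of_cesnavicius`).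
[OURS · conditional-result] [cite: Cesnavicius2021, Thm. 5.3] -/
theorem cmSupplier_of_cesnavicius (hM : CesnaviciusBlowupMacaulayfication.{0}) :
    ∀ (p : ℕ), p.Prime → ∀ {k : Type} [Field k] [CharP k p] {X : Scheme.{0}} (f : X ⟶ Spec (.of k))
      [LocallyOfFiniteType f] [IsIntegral X] (x : X), ringKrullDim (X.presheaf.stalk x) ≠ 0 →
      ∀ (S' : Scheme.{0}) (g : S' ⟶ Spec (X.presheaf.stalk x)) (I : (Spec (X.presheaf.stalk x)).IdealSheafData),
        I ≠ ⊥ → IsBlowup g I → (∀ s : S', g.base s ≠ closedPoint (X.presheaf.stalk x) → s ∈ Scheme.regularLocus S') →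
        ∃ 𝓚 : S'.IdealSheafData, 𝓚 ≠ ⊥ ∧ (∀ s ∈ (𝓚.support : Set S'), g.base s = closedPoint (X.presheaf.stalk x)) ∧
          ∀ (S'' : Scheme.{0}) (π : S'' ⟶ S'), IsBlowup π 𝓚 → ∀ s : S'', IsDomain (S''.presheaf.stalk s) ∧ CMCl (S''.presheaf.stalk s) :=
  cmSupplier_of_cesnaviciusOffClosed (OfCesnaviciusFact.cesnaviciusOffClosed_of_cesnavicius hM)

/-! ## §2 The slices BY NAME -/

/-- ★ **THE DIM ≤ d SLICE BY NAME (reading (B), door v37's named fact)**: on schemes of dimension `≤ d` the crux ⟸ {CP 1.1, 081R, CP 4.4, Česnavičius 5.3} ∧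
the transcendental-field rungs at levels `4 … d − 1` ∧ the F-half at levels `4 … d`. [OURS · conditional-result] [cite: Cesnavicius2021, Thm. 5.3]
[cite: CossartPiltant2019, Thm. 1.1; Prop. 4.4] [cite: Temkin2008, Prop. 2.3.4] -/
theorem fInjectiveMacaulayfication_dimLe_of_cesnaviciusOffClosed_of_rungs_of_F (d : ℕ)
    (hG : CossartPiltant2019General.{0}) (h081R : Stacks081R.{0}) (hP : CossartPiltant2019Principalization.{0})
    (hM : CesnaviciusBlowupMacaulayficationOffClosed.{0})
    (hR : ∀ p e r : ℕ, p.Prime → 4 ≤ e → e + 1 ≤ d → 1 ≤ r → ClosedPointLocalResolutionAdmTr p e r)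
    (hF : ∀ n : ℕ, 4 ≤ n → n ≤ d → ∀ (p : ℕ), p.Prime → ∀ (k : Type) [Field k] [CharP k p]
    (X : Scheme.{0}) (f : X ⟶ Spec (.of k)),
      IsSeparated f → LocallyOfFiniteType f → QuasiCompact f → IsIntegral X →
      ∀ x : X, IsClosed ({x} : Set X) → x ∉ Scheme.regularLocus X → ringKrullDim (X.presheaf.stalk x) = n →
      ∀ (S' : Scheme.{0}) (g : S' ⟶ Spec (X.presheaf.stalk x)) (I : (Spec (X.presheaf.stalk x)).IdealSheafData),
        I ≠ ⊥ → (I.support : Set (Spec (X.presheaf.stalk x))) ⊆ (Scheme.regularLocus (Spec (X.presheaf.stalk x)))ᶜ → IsBlowup g I →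
        (∀ s : S', g.base s ≠ closedPoint (X.presheaf.stalk x) → s ∈ Scheme.regularLocus S') →
        (∀ s : S', CMCl (S'.presheaf.stalk s)) →
        ∃ 𝓚 : S'.IdealSheafData, 𝓚 ≠ ⊥ ∧ (∀ s ∈ (𝓚.support : Set S'), g.base s = closedPoint (X.presheaf.stalk x)) ∧
          ∀ (S'' : Scheme.{0}) (π : S'' ⟶ S'), IsBlowup π 𝓚 →
            ∀ s : S'', FullCl p (S''.presheaf.stalk s)) :
    ∀ p : ℕ, p.Prime → ∀ (k : Type) [Field k] [CharP k p] (X : Scheme.{0}) (f : X ⟶ Spec (.of k)),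
      IsSeparated f → LocallyOfFiniteType f → QuasiCompact f → IsReduced X → topologicalKrullDim X ≤ d →
      ∃ (X' : Scheme.{0}) (π : X' ⟶ X), IsProper π ∧ IsBirational π ∧ ∀ x : X',
        IsDomain (X'.presheaf.stalk x) ∧ ∀ d : ℕ, ringKrullDim (X'.presheaf.stalk x) = d →
          ∀ s : Fin d → X'.presheaf.stalk x, (Ideal.span (Set.range s)).radical.IsMaximal →
            RingTheory.Sequence.IsWeaklyRegular (X'.presheaf.stalk x) (List.ofFn s) ∧
            ∀ y : X'.presheaf.stalk x, (∃ e : ℕ, y ^ p ^ e ∈ Ideal.span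
              ((fun z : X'.presheaf.stalk x => z ^ p ^ e) ''
                (Ideal.span (Set.range s) : Set (X'.presheaf.stalk x)))) →
              y ∈ Ideal.span (Set.range s) :=
  fInjectiveMacaulayfication_dimLe_of_cm_of_rungs_of_F d hG h081R hP (cmSupplier_of_cesnaviciusOffClosed hM) hR hF

/-- The same with the registered F-half in full. [OURS · conditional-result] [cite: Cesnavicius2021, Thm. 5.3] [cite: CossartPiltant2019, Thm. 1.1; Prop. 4.4] -/
theorem fInjectiveMacaulayfication_dimLe_of_cesnaviciusOffClosed_of_rungs_of_LFadmF (d : ℕ)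
    (hG : CossartPiltant2019General.{0}) (h081R : Stacks081R.{0}) (hP : CossartPiltant2019Principalization.{0})
    (hM : CesnaviciusBlowupMacaulayficationOffClosed.{0})
    (hR : ∀ p e r : ℕ, p.Prime → 4 ≤ e → e + 1 ≤ d → 1 ≤ r → ClosedPointLocalResolutionAdmTr p e r)
    (hLF : LocalFullificationFibreAdmGe4Split.LocalFInjectivizationFibreAdmGe4) :
    ∀ p : ℕ, p.Prime → ∀ (k : Type) [Field k] [CharP k p] (X : Scheme.{0}) (f : X ⟶ Spec (.of k)),
      IsSeparated f → LocallyOfFiniteType f → QuasiCompact f → IsReduced X → topologicalKrullDim X ≤ d →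
      ∃ (X' : Scheme.{0}) (π : X' ⟶ X), IsProper π ∧ IsBirational π ∧ ∀ x : X',
        IsDomain (X'.presheaf.stalk x) ∧ ∀ d : ℕ, ringKrullDim (X'.presheaf.stalk x) = d →
          ∀ s : Fin d → X'.presheaf.stalk x, (Ideal.span (Set.range s)).radical.IsMaximal →
            RingTheory.Sequence.IsWeaklyRegular (X'.presheaf.stalk x) (List.ofFn s) ∧
            ∀ y : X'.presheaf.stalk x, (∃ e : ℕ, y ^ p ^ e ∈ Ideal.span
              ((fun z : X'.presheaf.stalk x => z ^ p ^ e) ''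
                (Ideal.span (Set.range s) : Set (X'.presheaf.stalk x)))) →
              y ∈ Ideal.span (Set.range s) :=
  fInjectiveMacaulayfication_dimLe_of_cm_of_rungs_of_LFadmF d hG h081R hP (cmSupplier_of_cesnaviciusOffClosed hM) hR hLF

/-- The (A)-name twin. [OURS · conditional-result] [cite: Cesnavicius2021, Thm. 5.3] [cite: CossartPiltant2019, Thm. 1.1; Prop. 4.4] -/
theorem fInjectiveMacaulayfication_dimLe_of_cesnavicius_of_rungs_of_F (d : ℕ)
    (hG : CossartPiltant2019General.{0}) (h081R : Stacks081R.{0}) (hP : CossartPiltant2019Principalization.{0})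
    (hM : CesnaviciusBlowupMacaulayfication.{0})
    (hR : ∀ p e r : ℕ, p.Prime → 4 ≤ e → e + 1 ≤ d → 1 ≤ r → ClosedPointLocalResolutionAdmTr p e r)
    (hF : ∀ n : ℕ, 4 ≤ n → n ≤ d → ∀ (p : ℕ), p.Prime → ∀ (k : Type) [Field k] [CharP k p]
    (X : Scheme.{0}) (f : X ⟶ Spec (.of k)),
      IsSeparated f → LocallyOfFiniteType f → QuasiCompact f → IsIntegral X →
      ∀ x : X, IsClosed ({x} : Set X) → x ∉ Scheme.regularLocus X → ringKrullDim (X.presheaf.stalk x) = n →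
      ∀ (S' : Scheme.{0}) (g : S' ⟶ Spec (X.presheaf.stalk x)) (I : (Spec (X.presheaf.stalk x)).IdealSheafData),
        I ≠ ⊥ → (I.support : Set (Spec (X.presheaf.stalk x))) ⊆ (Scheme.regularLocus (Spec (X.presheaf.stalk x)))ᶜ → IsBlowup g I →
        (∀ s : S', g.base s ≠ closedPoint (X.presheaf.stalk x) → s ∈ Scheme.regularLocus S') →
        (∀ s : S', CMCl (S'.presheaf.stalk s)) →
        ∃ 𝓚 : S'.IdealSheafData, 𝓚 ≠ ⊥ ∧ (∀ s ∈ (𝓚.support : Set S'), g.base s = closedPoint (X.presheaf.stalk x)) ∧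
          ∀ (S'' : Scheme.{0}) (π : S'' ⟶ S'), IsBlowup π 𝓚 →
            ∀ s : S'', FullCl p (S''.presheaf.stalk s)) :
    ∀ p : ℕ, p.Prime → ∀ (k : Type) [Field k] [CharP k p] (X : Scheme.{0}) (f : X ⟶ Spec (.of k)),
      IsSeparated f → LocallyOfFiniteType f → QuasiCompact f → IsReduced X → topologicalKrullDim X ≤ d →
      ∃ (X' : Scheme.{0}) (π : X' ⟶ X), IsProper π ∧ IsBirational π ∧ ∀ x : X',
        IsDomain (X'.presheaf.stalk x) ∧ ∀ d : ℕ, ringKrullDim (X'.presheaf.stalk x) = d →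
          ∀ s : Fin d → X'.presheaf.stalk x, (Ideal.span (Set.range s)).radical.IsMaximal →
            RingTheory.Sequence.IsWeaklyRegular (X'.presheaf.stalk x) (List.ofFn s) ∧
            ∀ y : X'.presheaf.stalk x, (∃ e : ℕ, y ^ p ^ e ∈ Ideal.span
              ((fun z : X'.presheaf.stalk x => z ^ p ^ e) ''
                (Ideal.span (Set.range s) : Set (X'.presheaf.stalk x)))) →
              y ∈ Ideal.span (Set.range s) :=
  fInjectiveMacaulayfication_dimLe_of_cm_of_rungs_of_F d hG h081R hP (cmSupplier_of_cesnavicius hM) hR hF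

/-- ★★ **THE DIM ≤ 4 SLICE BY NAME: on schemes of dimension `≤ 4` the crux ⟸ FOUR PUBLISHED THEOREMS {CP 2019 Thm 1.1, R–G 081R, CP 2019 Prop 4.4,
Česnavičius 2021 Thm 5.3} ∧ THE F-HALF AT LEVEL 4 — NO resolution residue.** [OURS · conditional-result: conditional on the CANDIDATE F-half at level 4]
[cite: Cesnavicius2021, Thm. 5.3] [cite: CossartPiltant2019, Thm. 1.1 (i)(ii); Prop. 4.4] [cite: RaynaudGruson1971, Thm. 5.2.2] [cite: Temkin2008, Prop. 2.3.4] -/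
theorem fInjectiveMacaulayfication_dimLe4_of_cesnaviciusOffClosed_of_F4
    (hG : CossartPiltant2019General.{0}) (h081R : Stacks081R.{0}) (hP : CossartPiltant2019Principalization.{0})
    (hM : CesnaviciusBlowupMacaulayficationOffClosed.{0})
    (hF4 : ∀ (p : ℕ), p.Prime → ∀ (k : Type) [Field k] [CharP k p]
    (X : Scheme.{0}) (f : X ⟶ Spec (.of k)),
      IsSeparated f → LocallyOfFiniteType f → QuasiCompact f → IsIntegral X →
      ∀ x : X, IsClosed ({x} : Set X) → x ∉ Scheme.regularLocus X → ringKrullDim (X.presheaf.stalk x) = 4 →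
      ∀ (S' : Scheme.{0}) (g : S' ⟶ Spec (X.presheaf.stalk x)) (I : (Spec (X.presheaf.stalk x)).IdealSheafData),
        I ≠ ⊥ → (I.support : Set (Spec (X.presheaf.stalk x))) ⊆ (Scheme.regularLocus (Spec (X.presheaf.stalk x)))ᶜ → IsBlowup g I →
        (∀ s : S', g.base s ≠ closedPoint (X.presheaf.stalk x) → s ∈ Scheme.regularLocus S') →
        (∀ s : S', CMCl (S'.presheaf.stalk s)) →
        ∃ 𝓚 : S'.IdealSheafData, 𝓚 ≠ ⊥ ∧ (∀ s ∈ (𝓚.support : Set S'), g.base s = closedPoint (X.presheaf.stalk x)) ∧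
          ∀ (S'' : Scheme.{0}) (π : S'' ⟶ S'), IsBlowup π 𝓚 →
            ∀ s : S'', FullCl p (S''.presheaf.stalk s)) :
    ∀ p : ℕ, p.Prime → ∀ (k : Type) [Field k] [CharP k p] (X : Scheme.{0}) (f : X ⟶ Spec (.of k)),
      IsSeparated f → LocallyOfFiniteType f → QuasiCompact f → IsReduced X → topologicalKrullDim X ≤ 4 →
      ∃ (X' : Scheme.{0}) (π : X' ⟶ X), IsProper π ∧ IsBirational π ∧ ∀ x : X',
        IsDomain (X'.presheaf.stalk x) ∧ ∀ d : ℕ, ringKrullDim (X'.presheaf.stalk x) = d →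
          ∀ s : Fin d → X'.presheaf.stalk x, (Ideal.span (Set.range s)).radical.IsMaximal →
            RingTheory.Sequence.IsWeaklyRegular (X'.presheaf.stalk x) (List.ofFn s) ∧
            ∀ y : X'.presheaf.stalk x, (∃ e : ℕ, y ^ p ^ e ∈ Ideal.span
              ((fun z : X'.presheaf.stalk x => z ^ p ^ e) ''
                (Ideal.span (Set.range s) : Set (X'.presheaf.stalk x)))) →
              y ∈ Ideal.span (Set.range s) := by
  refine fInjectiveMacaulayfication_dimLe_of_cesnaviciusOffClosed_of_rungs_of_F 4 hG h081R hP hM (fun p e r _ he hed _ => by omega) ?_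
  intro n hn hn4
  obtain rfl : n = 4 := le_antisymm hn4 hn
  exact hF4

/-- ★ **THE DIM ≤ 5 SLICE BY NAME: on schemes of dimension `≤ 5` the crux ⟸ FOUR PUBLISHED THEOREMS ∧ closed-point admissible local resolution of 4-FOLDS
over `k(X₁,…,X_r)`, `r ≥ 1` (`ClosedPointLocalResolutionAdmTr p 4 r`) ∧ the F-half at levels 4 and 5.** [OURS · conditional-result]
[cite: Cesnavicius2021, Thm. 5.3] [cite: CossartPiltant2019, Thm. 1.1 (i)(ii); Prop. 4.4] [cite: Temkin2008, Prop. 2.3.4] -/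
theorem fInjectiveMacaulayfication_dimLe5_of_cesnaviciusOffClosed_of_tr4_of_F45
    (hG : CossartPiltant2019General.{0}) (h081R : Stacks081R.{0}) (hP : CossartPiltant2019Principalization.{0})
    (hM : CesnaviciusBlowupMacaulayficationOffClosed.{0})
    (hR4 : ∀ p r : ℕ, p.Prime → 1 ≤ r → ClosedPointLocalResolutionAdmTr p 4 r)
    (hF4 : ∀ (p : ℕ), p.Prime → ∀ (k : Type) [Field k] [CharP k p]
    (X : Scheme.{0}) (f : X ⟶ Spec (.of k)),
      IsSeparated f → LocallyOfFiniteType f → QuasiCompact f → IsIntegral X →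
      ∀ x : X, IsClosed ({x} : Set X) → x ∉ Scheme.regularLocus X → ringKrullDim (X.presheaf.stalk x) = 4 →
      ∀ (S' : Scheme.{0}) (g : S' ⟶ Spec (X.presheaf.stalk x)) (I : (Spec (X.presheaf.stalk x)).IdealSheafData),
        I ≠ ⊥ → (I.support : Set (Spec (X.presheaf.stalk x))) ⊆ (Scheme.regularLocus (Spec (X.presheaf.stalk x)))ᶜ → IsBlowup g I →
        (∀ s : S', g.base s ≠ closedPoint (X.presheaf.stalk x) → s ∈ Scheme.regularLocus S') →
        (∀ s : S', CMCl (S'.presheaf.stalk s)) →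
        ∃ 𝓚 : S'.IdealSheafData, 𝓚 ≠ ⊥ ∧ (∀ s ∈ (𝓚.support : Set S'), g.base s = closedPoint (X.presheaf.stalk x)) ∧
          ∀ (S'' : Scheme.{0}) (π : S'' ⟶ S'), IsBlowup π 𝓚 →
            ∀ s : S'', FullCl p (S''.presheaf.stalk s))
    (hF5 : ∀ (p : ℕ), p.Prime → ∀ (k : Type) [Field k] [CharP k p]
    (X : Scheme.{0}) (f : X ⟶ Spec (.of k)),
      IsSeparated f → LocallyOfFiniteType f → QuasiCompact f → IsIntegral X →
      ∀ x : X, IsClosed ({x} : Set X) → x ∉ Scheme.regularLocus X → ringKrullDim (X.presheaf.stalk x) = 5 →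
      ∀ (S' : Scheme.{0}) (g : S' ⟶ Spec (X.presheaf.stalk x)) (I : (Spec (X.presheaf.stalk x)).IdealSheafData),
        I ≠ ⊥ → (I.support : Set (Spec (X.presheaf.stalk x))) ⊆ (Scheme.regularLocus (Spec (X.presheaf.stalk x)))ᶜ → IsBlowup g I →
        (∀ s : S', g.base s ≠ closedPoint (X.presheaf.stalk x) → s ∈ Scheme.regularLocus S') →
        (∀ s : S', CMCl (S'.presheaf.stalk s)) →
        ∃ 𝓚 : S'.IdealSheafData, 𝓚 ≠ ⊥ ∧ (∀ s ∈ (𝓚.support : Set S'), g.base s = closedPoint (X.presheaf.stalk x)) ∧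
          ∀ (S'' : Scheme.{0}) (π : S'' ⟶ S'), IsBlowup π 𝓚 →
            ∀ s : S'', FullCl p (S''.presheaf.stalk s)) :
    ∀ p : ℕ, p.Prime → ∀ (k : Type) [Field k] [CharP k p] (X : Scheme.{0}) (f : X ⟶ Spec (.of k)),
      IsSeparated f → LocallyOfFiniteType f → QuasiCompact f → IsReduced X → topologicalKrullDim X ≤ 5 →
      ∃ (X' : Scheme.{0}) (π : X' ⟶ X), IsProper π ∧ IsBirational π ∧ ∀ x : X',
        IsDomain (X'.presheaf.stalk x) ∧ ∀ d : ℕ, ringKrullDim (X'.presheaf.stalk x) = d →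
          ∀ s : Fin d → X'.presheaf.stalk x, (Ideal.span (Set.range s)).radical.IsMaximal →
            RingTheory.Sequence.IsWeaklyRegular (X'.presheaf.stalk x) (List.ofFn s) ∧
            ∀ y : X'.presheaf.stalk x, (∃ e : ℕ, y ^ p ^ e ∈ Ideal.span
              ((fun z : X'.presheaf.stalk x => z ^ p ^ e) ''
                (Ideal.span (Set.range s) : Set (X'.presheaf.stalk x)))) →
              y ∈ Ideal.span (Set.range s) := by
  refine fInjectiveMacaulayfication_dimLe_of_cesnaviciusOffClosed_of_rungs_of_F 5 hG h081R hP hM (fun p e r hp he hed hr => ?_) ?_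
  · obtain rfl : e = 4 := by omega
    exact hR4 p r hp hr
  · intro n hn hn5
    rcases Nat.lt_or_ge n 5 with h | h
    · obtain rfl : n = 4 := by omega
      exact hF4
    · obtain rfl : n = 5 := le_antisymm hn5 h
      exact hF5

end Summit.ResolutionOfSingularities.ResolutionOfSingularities.Theorems.FInjectiveMacaulayfication.DimSliceOfCesnavicius

end
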